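import Summits.BirchSwinnertonDyer.BirchSwinnertonDyer.Theorems.SylvesterTwoHeegnerIndexUpperOnV0
import HarnessLib

/-!
# Route `SylvesterTwoHeegnerIndex` (rung K7t): the GLUE of the cascade-E2 split of crux
# `HeegnerIndexUpperAtTwoHSYOfFactsPlus` (item 19725) — children ⟹ parent

Cell «bsd-cm» (`run/shared/lean/pub/bsd-cm/`), seat `bsd-cm-k7t-c3` (prover, gen 6; any K7t hand may
file the glue, planner START-HERE g19). HONEST FRAMING: this file is COMPOSITION ONLY. It proves the
glue item `HeegnerIndexUpperOfPartsPlusHSY` (stmt-BirchSwinnertonDyer-19805):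
`HSYPointTwoDivisibleSevenModNine → TwoAdicPairHSYOfFactsPlusOfThmC → UpperOffV0HSYPlus →
HeegnerIndexUpperAtTwoHSYOfFactsPlus`, i.e. that the three children of the split imply the parent.
Nothing is asserted about the children (memo THEOREM C, the closable pair statement, the off-`𝒱₀`
`2`-adic Kolyvagin bound): they enter as hypotheses. The proof is the planner's five-line term over
k7t-c2's landed glue `SylvesterTwoUpper.upperOfFacts_of_twoAdicPair_of_offV0` (p431798/p433825):
the pair statement (child 2 applied to the facts-plus antecedent and to THEOREM C) is its section
binder `hBC`, the off-`𝒱₀` child (applied to the facts-plus antecedent) is its `hoff`, and the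
resulting `HeegnerIndexUpperAtTwoHSYOfFacts` is applied to the `PublishedFactsTwo` part of the
antecedent. Closes no cell; BSD is not claimed; the UPPER crux stays open in its children.

PARTITION (D-0054): CornerF at `p = 2` (B14/O12) × 𝒞_HSY (`E_p : x³ + y³ = p`, `p ≡ 4, 7 (mod 9)`
prime, `3 ∉ 𝔽_p^{×3}`) × `p = 2` — glue (closes the glue item of the E2 split only; moves no label).
-/

-- the Theorems namespace `Summit.BirchSwinnertonDyer.BirchSwinnertonDyer.…` repeats a component by design (D-0017 layout)
set_option linter.dupNamespace false

namespace Summit.BirchSwinnertonDyer.BirchSwinnertonDyer.Theorems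

open Summit.BirchSwinnertonDyer.BirchSwinnertonDyer.Theses.SylvesterTwoHeegnerIndex

/-- **GLUE of the E2 split (item 19805): the children imply the parent.** Given THEOREM C
(`HSYPointTwoDivisibleSevenModNine`), the facts-plus pair statement
(`TwoAdicPairHSYOfFactsPlusOfThmC`) and the off-`𝒱₀` bound (`UpperOffV0HSYPlus`), the UPPER crux
`HeegnerIndexUpperAtTwoHSYOfFactsPlus` follows, by k7t-c2's landed glue
`SylvesterTwoUpper.upperOfFacts_of_twoAdicPair_of_offV0`. Composition only. [folklore] -/
theorem heegnerIndexUpperOfPartsPlusHSY_proof : HeegnerIndexUpperOfPartsPlusHSY :=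
  fun hT hP hO hFP =>
    (SylvesterTwoUpper.upperOfFacts_of_twoAdicPair_of_offV0 (hP hFP hT) (fun _ => hO hFP)) hFP.1

end Summit.BirchSwinnertonDyer.BirchSwinnertonDyer.Theorems
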